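import Summits.HodgeConjecture.HodgeConjecture.Theorems.F0P3CMBorelIwahoriDatum                  -- ★ `exists_cmIwahoriDatum` (the `(𝓘, K₀)` package of `U(Φ₃)`: clause shapes 5 and 11)
import Summits.HodgeConjecture.HodgeConjecture.Theorems.F0P3cCMBorelIwahoriDatumU2               -- ★ `exists_cmIwahoriDatum₂_of_model` (the `N = 2` package: same clause shapes)
import Summits.HodgeConjecture.HodgeConjecture.Theorems.F0P3U3PrincipalSeriesOpenCellTorusChar     -- ★ `exists_weylElt_three`
import Summits.HodgeConjecture.HodgeConjecture.Theorems.F0P3cU2PrincipalSeriesOpenCellTorusChar    -- ★ `exists_weylElt_two`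
import Literature.NumberTheory.Automorphic.UnitaryGroupWeylInversion                              -- ★ `StdForm.unit_over_mem_glInt`, `StdForm.coe_unit_over`
import HarnessLib

/-!
# «K0-WEYL-G» — the long Weyl element is integral in the one-place model, hence normalises every Iwahori level

Road (D) «DEEP-FL» of organ residual «XIG-St» (crux H413, line `F0_P3c_StCharTSPaydown`), G side (and the `N = 2` twin for the
H side).  The CM Iwahori-datum packages ★ `exists_cmIwahoriDatum` (`U(Φ₃)(L⁺_v)`) ∕ ★ `exists_cmIwahoriDatum₂_of_model` (`U(Φ₂)(L⁺_v)`)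
at a non-split `v` deliver `(𝓘, K₀)` with, among their clauses,

* (5)  `∀ n, ∀ k ∈ K₀, ∀ κ ∈ 𝓘.K n, k⁻¹ * κ * k ∈ 𝓘.K n` (the levels are normalised by `K₀`), and
* (11) `∀ k, k ∈ K₀ ↔ E k ∈ GL_N(𝒪_w)` (`K₀` is the pull-back of `GL_N(𝒪_w)` under the one-place model `E = localNonsplitEquiv`).

This file proves that the long Weyl element `w₀` (the element of `U(Φ_N)(L⁺_v)` whose matrix IS the form `Φ_N`, ★ `exists_weylElt_three` ∕
★ `exists_weylElt_two`) satisfies `E w₀ = Φ_N ∈ GL_N(𝒪_w)` (a signed permutation matrix with `Φ_N⁻¹ = Φ_N`, ★ `StdForm.unit_over_mem_glInt`),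
hence `w₀ ∈ K₀` by (11), hence by (5) at `k := w₀⁻¹`

  `hKw : ∀ n, ∀ κ ∈ 𝓘.K n, w₀ * κ * w₀⁻¹ ∈ 𝓘.K n`

— the `w₀`-stability of the levels that the shell-trace bricks («HF1-SHELL», F1-G's `hiff`, F1-H) take as a hypothesis.

THEOREMS ONLY; no `def`, no `instance`; classical trio.

## References
* [Rogawski1990] J. D. Rogawski, *Automorphic Representations of Unitary Groups in Three Variables* (1990), §1.10 p. 9 (the form `Φ_N`, the Weyl element).
* [Casselman1995] W. Casselman, *Introduction to the theory of admissible representations of p-adic reductive groups* (1995), Prop. 1.4.4 p. 14 (Iwahori factorisation; levels normalised by `K₀`).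
* [Corvallis1979] J. Tits, *Reductive groups over local fields*, Proc. Symp. Pure Math. 33 (1979), §3.8 (`GL_N(𝒪)` hyperspecial).
* [PlatonovRapinchuk1994] V. Platonov, A. Rapinchuk, *Algebraic Groups and Number Theory* (1994), §5.1 (the one-place model).
-/

set_option autoImplicit false
set_option linter.dupNamespace false

noncomputable section

open scoped MatrixGroups
open Literature.NumberTheory.Automorphic Literature.NumberTheory.Automorphic.UnitaryGroup
open _root_.NumberField _root_.IsDedekindDomain
open Literature.NumberTheory (Rogawski1990.qsForm)

-- the mandated namespace has the single-problem summit's repeated segment (`HodgeConjecture.HodgeConjecture`)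
namespace Summit.HodgeConjecture.HodgeConjecture.Cruxes.H413.F0P3cStCharTSK0WeylG

/-! ## §1 A group lemma: clause (5) at `k := w₀⁻¹` -/

/-- If every `k ∈ K₀` satisfies `k⁻¹ κ k ∈ K` for all `κ ∈ K`, then every `w₀ ∈ K₀` satisfies `w₀ κ w₀⁻¹ ∈ K` (take `k := w₀⁻¹ ∈ K₀`).
[cite: Casselman1995, Prop. 1.4.4 p. 14] -/
theorem mul_mul_inv_mem_of_forall_inv_mul_mul_mem {G : Type*} [Group G] {K₀ K : Subgroup G}
    (h : ∀ k ∈ K₀, ∀ κ ∈ K, k⁻¹ * κ * k ∈ K) {w₀ : G} (hw₀ : w₀ ∈ K₀) :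
    ∀ κ ∈ K, w₀ * κ * w₀⁻¹ ∈ K := by
  intro κ hκ
  have h' := h w₀⁻¹ (K₀.inv_mem hw₀) κ hκ
  rwa [inv_inv] at h'

/-! ## §2 `U(Φ₃)`: the long Weyl element is integral in the one-place model (G side) -/

section Three

variable (L : Type) [Field L] [NumberField L] [IsCMField L] (v : HeightOneSpectrum (𝓞 ↥(maximalRealSubfield L)))
  (w : PlacesOver L v) (hw : IsCMField.complexConj L • w.1 = w.1)

/-- **`E₃ w₀ = Φ₃`**: the model matrix of the long Weyl element of `U(Φ₃)(L⁺_v)` (matrix `cmLocalForm L 3 v`) is `Φ₃` over `L_w` (★ `coe_localNonsplitEquiv_apply`: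
entrywise evaluation at `w`; ★ `cmLocalForm_eq_over`, `StdForm.over_map`). [cite: Rogawski1990, §1.10 p. 9] [cite: PlatonovRapinchuk1994, §5.1] -/
theorem coe_localNonsplitEquiv_weylElt_three
    (w₀ : ↥(unitaryGroupOfForm (conjLocal L (IsCMField.complexConj L) v) (cmLocalForm L 3 v)))
    (hw₀ : Units.val (w₀ : GL (Fin 3) (LocalRing L v)) = cmLocalForm L 3 v) :
    ((((localNonsplitEquiv (IsCMField.complexConj L) (Rogawski1990.qsForm L) (IsCMField.complexConj_ne_one L) w hw) w₀ :
        ↥(unitaryGroupOfForm (galAdicCompletionMap (L := L) (IsCMField.complexConj L) hw) (placeForm (Rogawski1990.qsForm L) w.1))) :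
          GL (Fin 3) (w.1.adicCompletion L)) : Matrix (Fin 3) (Fin 3) (w.1.adicCompletion L)) =
      (StdForm.antidiagonal 3).over (w.1.adicCompletion L) := by
  rw [coe_localNonsplitEquiv_apply L (Rogawski1990.qsForm L) v w hw w₀, hw₀, cmLocalForm_eq_over, StdForm.over_map]

/-- **`E₃ w₀` IS the unit `Φ₃` of `GL₃(L_w)`** (★ `StdForm.coe_unit_over`). [cite: Rogawski1990, §1.10 p. 9] -/
theorem localNonsplitEquiv_weylElt_eq_unit_three
    (w₀ : ↥(unitaryGroupOfForm (conjLocal L (IsCMField.complexConj L) v) (cmLocalForm L 3 v)))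
    (hw₀ : Units.val (w₀ : GL (Fin 3) (LocalRing L v)) = cmLocalForm L 3 v) :
    (((localNonsplitEquiv (IsCMField.complexConj L) (Rogawski1990.qsForm L) (IsCMField.complexConj_ne_one L) w hw) w₀ :
        ↥(unitaryGroupOfForm (galAdicCompletionMap (L := L) (IsCMField.complexConj L) hw) (placeForm (Rogawski1990.qsForm L) w.1))) :
          GL (Fin 3) (w.1.adicCompletion L)) =
      ((StdForm.antidiagonal 3).isUnit_over (w.1.adicCompletion L)).unit :=
  Units.ext (by rw [coe_localNonsplitEquiv_weylElt_three L v w hw w₀ hw₀, StdForm.coe_unit_over])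

/-- **The long Weyl element is integral in the model: `E₃ w₀ ∈ GL₃(𝒪_w)`** (`Φ₃` is a permutation matrix with `Φ₃⁻¹ = Φ₃`, ★ `StdForm.unit_over_mem_glInt`).
[cite: Corvallis1979, Tits §3.8] [cite: Rogawski1990, §1.10 p. 9] -/
theorem localNonsplitEquiv_weylElt_mem_glInt_three
    (w₀ : ↥(unitaryGroupOfForm (conjLocal L (IsCMField.complexConj L) v) (cmLocalForm L 3 v)))
    (hw₀ : Units.val (w₀ : GL (Fin 3) (LocalRing L v)) = cmLocalForm L 3 v) :
    (((localNonsplitEquiv (IsCMField.complexConj L) (Rogawski1990.qsForm L) (IsCMField.complexConj_ne_one L) w hw) w₀ :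
        ↥(unitaryGroupOfForm (galAdicCompletionMap (L := L) (IsCMField.complexConj L) hw) (placeForm (Rogawski1990.qsForm L) w.1))) :
          GL (Fin 3) (w.1.adicCompletion L)) ∈ glInt 3 (w.1.adicCompletion L) := by
  rw [localNonsplitEquiv_weylElt_eq_unit_three L v w hw w₀ hw₀]
  exact StdForm.unit_over_mem_glInt _

/-- **(a) `w₀ ∈ K₀`** for every subgroup `K₀ ≤ U(Φ₃)(L⁺_v)` characterised by clause (11) of ★ `exists_cmIwahoriDatum` (`k ∈ K₀ ↔ E₃ k ∈ GL₃(𝒪_w)`).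
[cite: Casselman1995, Prop. 1.4.4 p. 14] [cite: Rogawski1990, §1.10 p. 9] -/
theorem weylElt_mem_of_iff_glInt_three
    (K₀ : Subgroup ↥(unitaryGroupOfForm (conjLocal L (IsCMField.complexConj L) v) (cmLocalForm L 3 v)))
    (hK₀ : ∀ k : ↥(unitaryGroupOfForm (conjLocal L (IsCMField.complexConj L) v) (cmLocalForm L 3 v)), k ∈ K₀ ↔
      ((((localNonsplitEquiv (IsCMField.complexConj L) (Rogawski1990.qsForm L) (IsCMField.complexConj_ne_one L) w hw) k :
        ↥(unitaryGroupOfForm (galAdicCompletionMap (L := L) (IsCMField.complexConj L) hw) (placeForm (Rogawski1990.qsForm L) w.1))) :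
          GL (Fin 3) (w.1.adicCompletion L)) ∈ glInt 3 (w.1.adicCompletion L)))
    (w₀ : ↥(unitaryGroupOfForm (conjLocal L (IsCMField.complexConj L) v) (cmLocalForm L 3 v)))
    (hw₀ : Units.val (w₀ : GL (Fin 3) (LocalRing L v)) = cmLocalForm L 3 v) :
    w₀ ∈ K₀ :=
  (hK₀ w₀).2 (localNonsplitEquiv_weylElt_mem_glInt_three L v w hw w₀ hw₀)

/-- **(b) `hKw`: the long Weyl element normalises every level** — clauses (5) (`K₀` normalises `𝓘.K n`) and (11) of ★ `exists_cmIwahoriDatum` give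
`∀ κ ∈ 𝓘.K n, w₀ κ w₀⁻¹ ∈ 𝓘.K n` (clause (5) at `k := w₀⁻¹ ∈ K₀`).  This is the `hKw` input of the shell-trace bricks («HF1-SHELL», F1-G's `hiff`).
[cite: Casselman1995, Prop. 1.4.4 p. 14] [cite: Rogawski1990, §1.10 p. 9] -/
theorem weylElt_mul_mul_inv_mem_level_three (𝓘 : (cmBorelTriple L 3 v).IwahoriDatum)
    (K₀ : Subgroup ↥(unitaryGroupOfForm (conjLocal L (IsCMField.complexConj L) v) (cmLocalForm L 3 v)))
    (hKK₀ : ∀ n, ∀ k ∈ K₀, ∀ κ ∈ 𝓘.K n, k⁻¹ * κ * k ∈ 𝓘.K n)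
    (hK₀ : ∀ k : ↥(unitaryGroupOfForm (conjLocal L (IsCMField.complexConj L) v) (cmLocalForm L 3 v)), k ∈ K₀ ↔
      ((((localNonsplitEquiv (IsCMField.complexConj L) (Rogawski1990.qsForm L) (IsCMField.complexConj_ne_one L) w hw) k :
        ↥(unitaryGroupOfForm (galAdicCompletionMap (L := L) (IsCMField.complexConj L) hw) (placeForm (Rogawski1990.qsForm L) w.1))) :
          GL (Fin 3) (w.1.adicCompletion L)) ∈ glInt 3 (w.1.adicCompletion L)))
    (w₀ : ↥(unitaryGroupOfForm (conjLocal L (IsCMField.complexConj L) v) (cmLocalForm L 3 v)))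
    (hw₀ : Units.val (w₀ : GL (Fin 3) (LocalRing L v)) = cmLocalForm L 3 v) (n : ℕ) :
    ∀ κ ∈ 𝓘.K n, w₀ * κ * w₀⁻¹ ∈ 𝓘.K n :=
  mul_mul_inv_mem_of_forall_inv_mul_mul_mem (hKK₀ n) (weylElt_mem_of_iff_glInt_three L v w hw K₀ hK₀ w₀ hw₀)

/-- **(c) Packaged**: at a non-split `v`, for any `(𝓘, K₀)` with clauses (5) and (11) of ★ `exists_cmIwahoriDatum` there is a long Weyl element `w₀ ∈ K₀` (matrix `Φ₃`,
★ `exists_weylElt_three`) normalising every level `𝓘.K n`. [cite: Casselman1995, Prop. 1.4.4 p. 14] [cite: Rogawski1990, §1.10 p. 9] -/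
theorem exists_weylElt_mem_and_forall_mul_mul_inv_mem_three
    (hns : ∀ w' : PlacesOver L v, IsCMField.complexConj L • w'.1 = w'.1)
    (𝓘 : (cmBorelTriple L 3 v).IwahoriDatum)
    (K₀ : Subgroup ↥(unitaryGroupOfForm (conjLocal L (IsCMField.complexConj L) v) (cmLocalForm L 3 v)))
    (hKK₀ : ∀ n, ∀ k ∈ K₀, ∀ κ ∈ 𝓘.K n, k⁻¹ * κ * k ∈ 𝓘.K n)
    (hK₀ : ∀ k : ↥(unitaryGroupOfForm (conjLocal L (IsCMField.complexConj L) v) (cmLocalForm L 3 v)), k ∈ K₀ ↔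
      ((((localNonsplitEquiv (IsCMField.complexConj L) (Rogawski1990.qsForm L) (IsCMField.complexConj_ne_one L) w hw) k :
        ↥(unitaryGroupOfForm (galAdicCompletionMap (L := L) (IsCMField.complexConj L) hw) (placeForm (Rogawski1990.qsForm L) w.1))) :
          GL (Fin 3) (w.1.adicCompletion L)) ∈ glInt 3 (w.1.adicCompletion L))) :
    ∃ w₀ : ↥(unitaryGroupOfForm (conjLocal L (IsCMField.complexConj L) v) (cmLocalForm L 3 v)),
      Units.val (w₀ : GL (Fin 3) (LocalRing L v)) = cmLocalForm L 3 v ∧ w₀ ∈ K₀ ∧ ∀ n, ∀ κ ∈ 𝓘.K n, w₀ * κ * w₀⁻¹ ∈ 𝓘.K n := by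
  obtain ⟨w₀, hw₀⟩ := F0P3U3PrincipalSeriesOpenCellTorusChar.exists_weylElt_three L v hns
  exact ⟨w₀, hw₀, weylElt_mem_of_iff_glInt_three L v w hw K₀ hK₀ w₀ hw₀,
    fun n => weylElt_mul_mul_inv_mem_level_three L v w hw 𝓘 K₀ hKK₀ hK₀ w₀ hw₀ n⟩

end Three

/-! ## §3 `U(Φ₂)`: the `N = 2` twin (H side, second factor of `H = U(2) × U(1)`) -/

section Two

variable (L : Type) [Field L] [NumberField L] [IsCMField L] (v : HeightOneSpectrum (𝓞 ↥(maximalRealSubfield L)))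
  (w : PlacesOver L v) (hw : IsCMField.complexConj L • w.1 = w.1)

/-- **`E₂ w₀ = Φ₂`**: the model matrix of the long Weyl element of `U(Φ₂)(L⁺_v)` (matrix `cmLocalForm L 2 v`) is `Φ₂` over `L_w`.
[cite: Rogawski1990, §1.10 p. 9] [cite: PlatonovRapinchuk1994, §5.1] -/
theorem coe_localNonsplitEquiv_weylElt_two
    (w₀ : ↥(unitaryGroupOfForm (conjLocal L (IsCMField.complexConj L) v) (cmLocalForm L 2 v)))
    (hw₀ : Units.val (w₀ : GL (Fin 2) (LocalRing L v)) = cmLocalForm L 2 v) :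
    ((((localNonsplitEquiv (IsCMField.complexConj L) (Matrix.of fun i j : Fin 2 => if i.val + j.val + 1 = 2 then (1 : L) else 0)
        (IsCMField.complexConj_ne_one L) w hw) w₀ :
        ↥(unitaryGroupOfForm (galAdicCompletionMap (L := L) (IsCMField.complexConj L) hw)
          (placeForm (Matrix.of fun i j : Fin 2 => if i.val + j.val + 1 = 2 then (1 : L) else 0) w.1))) :
          GL (Fin 2) (w.1.adicCompletion L)) : Matrix (Fin 2) (Fin 2) (w.1.adicCompletion L)) =
      (StdForm.antidiagonal 2).over (w.1.adicCompletion L) := by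
  rw [coe_localNonsplitEquiv_apply L (Matrix.of fun i j : Fin 2 => if i.val + j.val + 1 = 2 then (1 : L) else 0) v w hw w₀, hw₀,
    cmLocalForm_eq_over, StdForm.over_map]

/-- **The long Weyl element of `U(Φ₂)` is integral in the model: `E₂ w₀ ∈ GL₂(𝒪_w)`** (★ `StdForm.unit_over_mem_glInt`).
[cite: Corvallis1979, Tits §3.8] [cite: Rogawski1990, §1.10 p. 9] -/
theorem localNonsplitEquiv_weylElt_mem_glInt_two
    (w₀ : ↥(unitaryGroupOfForm (conjLocal L (IsCMField.complexConj L) v) (cmLocalForm L 2 v)))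
    (hw₀ : Units.val (w₀ : GL (Fin 2) (LocalRing L v)) = cmLocalForm L 2 v) :
    (((localNonsplitEquiv (IsCMField.complexConj L) (Matrix.of fun i j : Fin 2 => if i.val + j.val + 1 = 2 then (1 : L) else 0)
        (IsCMField.complexConj_ne_one L) w hw) w₀ :
        ↥(unitaryGroupOfForm (galAdicCompletionMap (L := L) (IsCMField.complexConj L) hw)
          (placeForm (Matrix.of fun i j : Fin 2 => if i.val + j.val + 1 = 2 then (1 : L) else 0) w.1))) :
          GL (Fin 2) (w.1.adicCompletion L)) ∈ glInt 2 (w.1.adicCompletion L) := by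
  have he : (((localNonsplitEquiv (IsCMField.complexConj L) (Matrix.of fun i j : Fin 2 => if i.val + j.val + 1 = 2 then (1 : L) else 0)
        (IsCMField.complexConj_ne_one L) w hw) w₀ :
        ↥(unitaryGroupOfForm (galAdicCompletionMap (L := L) (IsCMField.complexConj L) hw)
          (placeForm (Matrix.of fun i j : Fin 2 => if i.val + j.val + 1 = 2 then (1 : L) else 0) w.1))) :
          GL (Fin 2) (w.1.adicCompletion L)) = ((StdForm.antidiagonal 2).isUnit_over (w.1.adicCompletion L)).unit :=
    Units.ext (by rw [coe_localNonsplitEquiv_weylElt_two L v w hw w₀ hw₀, StdForm.coe_unit_over])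
  rw [he]
  exact StdForm.unit_over_mem_glInt _

/-- **(a)₂ `w₀ ∈ K₀`** for every `K₀ ≤ U(Φ₂)(L⁺_v)` characterised by the last-but-one clause of ★ `exists_cmIwahoriDatum₂_of_model`
(`k ∈ K₀ ↔ E₂ k ∈ GL₂(𝒪_w)`). [cite: Casselman1995, Prop. 1.4.4 p. 14] [cite: Rogawski1990, §1.10 p. 9] -/
theorem weylElt_mem_of_iff_glInt_two
    (K₀ : Subgroup ↥(unitaryGroupOfForm (conjLocal L (IsCMField.complexConj L) v) (cmLocalForm L 2 v)))
    (hK₀ : ∀ k : ↥(unitaryGroupOfForm (conjLocal L (IsCMField.complexConj L) v) (cmLocalForm L 2 v)), k ∈ K₀ ↔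
      ((((localNonsplitEquiv (IsCMField.complexConj L) (Matrix.of fun i j : Fin 2 => if i.val + j.val + 1 = 2 then (1 : L) else 0)
          (IsCMField.complexConj_ne_one L) w hw) k :
        ↥(unitaryGroupOfForm (galAdicCompletionMap (L := L) (IsCMField.complexConj L) hw)
          (placeForm (Matrix.of fun i j : Fin 2 => if i.val + j.val + 1 = 2 then (1 : L) else 0) w.1))) :
          GL (Fin 2) (w.1.adicCompletion L)) ∈ glInt 2 (w.1.adicCompletion L)))
    (w₀ : ↥(unitaryGroupOfForm (conjLocal L (IsCMField.complexConj L) v) (cmLocalForm L 2 v)))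
    (hw₀ : Units.val (w₀ : GL (Fin 2) (LocalRing L v)) = cmLocalForm L 2 v) :
    w₀ ∈ K₀ :=
  (hK₀ w₀).2 (localNonsplitEquiv_weylElt_mem_glInt_two L v w hw w₀ hw₀)

/-- **(b)₂ `hKw` for `U(Φ₂)`**: the long Weyl element normalises every level of an Iwahori datum for ★ `cmBorelTriple L 2 v` whose levels are normalised by a `K₀`
characterised as in ★ `exists_cmIwahoriDatum₂_of_model`. [cite: Casselman1995, Prop. 1.4.4 p. 14] [cite: Rogawski1990, §1.10 p. 9] -/
theorem weylElt_mul_mul_inv_mem_level_two (𝓘 : (cmBorelTriple L 2 v).IwahoriDatum)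
    (K₀ : Subgroup ↥(unitaryGroupOfForm (conjLocal L (IsCMField.complexConj L) v) (cmLocalForm L 2 v)))
    (hKK₀ : ∀ n, ∀ k ∈ K₀, ∀ κ ∈ 𝓘.K n, k⁻¹ * κ * k ∈ 𝓘.K n)
    (hK₀ : ∀ k : ↥(unitaryGroupOfForm (conjLocal L (IsCMField.complexConj L) v) (cmLocalForm L 2 v)), k ∈ K₀ ↔
      ((((localNonsplitEquiv (IsCMField.complexConj L) (Matrix.of fun i j : Fin 2 => if i.val + j.val + 1 = 2 then (1 : L) else 0)
          (IsCMField.complexConj_ne_one L) w hw) k :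
        ↥(unitaryGroupOfForm (galAdicCompletionMap (L := L) (IsCMField.complexConj L) hw)
          (placeForm (Matrix.of fun i j : Fin 2 => if i.val + j.val + 1 = 2 then (1 : L) else 0) w.1))) :
          GL (Fin 2) (w.1.adicCompletion L)) ∈ glInt 2 (w.1.adicCompletion L)))
    (w₀ : ↥(unitaryGroupOfForm (conjLocal L (IsCMField.complexConj L) v) (cmLocalForm L 2 v)))
    (hw₀ : Units.val (w₀ : GL (Fin 2) (LocalRing L v)) = cmLocalForm L 2 v) (n : ℕ) :
    ∀ κ ∈ 𝓘.K n, w₀ * κ * w₀⁻¹ ∈ 𝓘.K n :=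
  mul_mul_inv_mem_of_forall_inv_mul_mul_mem (hKK₀ n) (weylElt_mem_of_iff_glInt_two L v w hw K₀ hK₀ w₀ hw₀)

/-- **(c)₂ Packaged** for `U(Φ₂)`: a long Weyl element `w₀ ∈ K₀` (matrix `Φ₂`, ★ `exists_weylElt_two`) normalising every level.
[cite: Casselman1995, Prop. 1.4.4 p. 14] [cite: Rogawski1990, §1.10 p. 9] -/
theorem exists_weylElt_mem_and_forall_mul_mul_inv_mem_two
    (hns : ∀ w' : PlacesOver L v, IsCMField.complexConj L • w'.1 = w'.1)
    (𝓘 : (cmBorelTriple L 2 v).IwahoriDatum)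
    (K₀ : Subgroup ↥(unitaryGroupOfForm (conjLocal L (IsCMField.complexConj L) v) (cmLocalForm L 2 v)))
    (hKK₀ : ∀ n, ∀ k ∈ K₀, ∀ κ ∈ 𝓘.K n, k⁻¹ * κ * k ∈ 𝓘.K n)
    (hK₀ : ∀ k : ↥(unitaryGroupOfForm (conjLocal L (IsCMField.complexConj L) v) (cmLocalForm L 2 v)), k ∈ K₀ ↔
      ((((localNonsplitEquiv (IsCMField.complexConj L) (Matrix.of fun i j : Fin 2 => if i.val + j.val + 1 = 2 then (1 : L) else 0)
          (IsCMField.complexConj_ne_one L) w hw) k :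
        ↥(unitaryGroupOfForm (galAdicCompletionMap (L := L) (IsCMField.complexConj L) hw)
          (placeForm (Matrix.of fun i j : Fin 2 => if i.val + j.val + 1 = 2 then (1 : L) else 0) w.1))) :
          GL (Fin 2) (w.1.adicCompletion L)) ∈ glInt 2 (w.1.adicCompletion L))) :
    ∃ w₀ : ↥(unitaryGroupOfForm (conjLocal L (IsCMField.complexConj L) v) (cmLocalForm L 2 v)),
      Units.val (w₀ : GL (Fin 2) (LocalRing L v)) = cmLocalForm L 2 v ∧ w₀ ∈ K₀ ∧ ∀ n, ∀ κ ∈ 𝓘.K n, w₀ * κ * w₀⁻¹ ∈ 𝓘.K n := by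
  obtain ⟨w₀, hw₀⟩ := F0P3cU2PrincipalSeriesOpenCellTorusChar.exists_weylElt_two L v hns
  exact ⟨w₀, hw₀, weylElt_mem_of_iff_glInt_two L v w hw K₀ hK₀ w₀ hw₀,
    fun n => weylElt_mul_mul_inv_mem_level_two L v w hw 𝓘 K₀ hKK₀ hK₀ w₀ hw₀ n⟩

end Two

end Summit.HodgeConjecture.HodgeConjecture.Cruxes.H413.F0P3cStCharTSK0WeylG

end
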